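import Summits.RiemannHypothesis.RiemannHypothesis.Theorems.GroundBartaEvenWinsBeyondArchDeflationForms
import Mathlib.Analysis.InnerProductSpace.Projection.Basic
import Mathlib.MeasureTheory.Function.L2Space
import HarnessLib

/-!
# RiemannHypothesis / GroundBarta — rung 4 (`EvenWinsBeyondArch`, stmt-RiemannHypothesis-18807):
# the deflated Temple (Lehmann–Maehly) L-side programme, III — the inclusion on the sector form domain

Helper file (`--supports stmt-RiemannHypothesis-18807`), RH-free, Mathlib + landed tree files only, no
definitions, no named facts.

`dt_deflation_core` is the DEFLATED TEMPLE / LEHMANN–MAEHLY INCLUSION for the closed windowed Weil form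
`E_c(f, h) = P(f, h) + 𝓔_c(f, h) − M_c⟨f, h⟩` on the sector form domain

  `D_c^σ = {f ∈ L²(ℝ) : f = 0 off [-c, c], Im f = 0, f(-x) = σ f(x), ∫₀^∞ ρ(t) D_t(f) dt < ∞}`

(σ = 1: even sector, σ = −1: odd sector): given real trial vectors `v₁ … v_k ∈ D_c^σ` with window images
`F_i ∈ L²` (`E_c(v_i, f) = ⟨F_i, f⟩` for all `f ∈ D_c^σ`), any coefficient matrix `W` (residuals
`r_i = F_i − Σ_l W_il v_l`; the best choice is the `L²`-projection onto `span v`, but ANY `W` is admissible), a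
complement bound `β ∫|h|² ≤ E_c(h, h)` for `h ∈ D_c^σ ⊥ v`, and `λ < β` with the `k × k` matrix
`(β − λ)(A − λ G) − R` positive semidefinite (`A = E_c(v, v)`, `G = ⟨v, v⟩`, `R = ⟨r, r⟩`), every `g ∈ D_c^σ`
obeys `λ ∫|g|² ≤ P(g) + 𝓔_c(g) − M_c ∫|g|²`.

Ingredients: `dt_deflatedFormBound₂` — the abstract inequality (the tree's
`Literature.Analysis.OperatorTheory.deflatedFormBound_of_decomp`, p179129, re-proved in the two-space form
needed here: the residuals live in `L²`, not in the form domain); `dt_exists_orthogonal_decomp` — the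
decomposition `g = Σ α_i v_i + h`, `h ⊥ v`, from the orthogonal projection onto the span of the real parts
in the Hilbert space `L²(ℝ; ℝ)` (Mathlib's `Submodule.starProjection`); and the bilinear bookkeeping of
`Theorems/GroundBartaEvenWinsBeyondArchDeflation{Increments,Forms}`, bundled here into genuine `ℝ`-bilinear maps
on the (locally constructed) submodules `D_c^σ ⊆ L²`.  Prover B, speedrun unit `sr-gb-rung-b` (gen 3).

References: A. Weinstein, W. Stenger, *Methods of Intermediate Problems for Eigenvalues* (1972) Ch. 5 §9
(Temple's formula, `ρ` from an intermediate problem); M. Reed, B. Simon, *Methods of Modern Mathematical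
Physics IV* (1978) Thm XIII.5; E. Bombieri, Rend. Mat. Acc. Lincei (9) 11 (2000) 183–233, Thm 2 and §4.
-/

set_option linter.dupNamespace false

noncomputable section

open MeasureTheory Set Filter
open scoped Topology ENNReal NNReal ComplexConjugate InnerProductSpace BigOperators

namespace Summit.RiemannHypothesis.RiemannHypothesis.Theorems.EvenWinsBeyondArch

open Literature.NumberTheory.LFunctions Literature.NumberTheory.LFunctions.ConnesVanSuijlekom
open Summit.RiemannHypothesis.RiemannHypothesis.Theorems.OddSector
  (weilIncrement₂ weilDirichletEnergy₂ weilPoleForm₂ weilIncrement₂_self weilDirichletEnergy₂_self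
    weilPoleForm₂_self re_mul_conj_self)

/-! ## The abstract deflated Temple inequality, two-space form -/

/-- A bilinear form evaluated on a finite linear combination in the first slot. -/
theorem dt_bilin_sum_smul_left {D P : Type*} [AddCommGroup D] [Module ℝ D] [AddCommGroup P] [Module ℝ P]
    (B : D →ₗ[ℝ] P →ₗ[ℝ] ℝ) {k : ℕ} (α : Fin k → ℝ) (v : Fin k → D) (y : P) :
    B (∑ i, α i • v i) y = ∑ i, α i * B (v i) y := by
  simp [map_sum, map_smul]

/-- A bilinear form evaluated on a finite linear combination in the second slot. -/
theorem dt_bilin_sum_smul_right {D P : Type*} [AddCommGroup D] [Module ℝ D] [AddCommGroup P] [Module ℝ P]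
    (B : P →ₗ[ℝ] D →ₗ[ℝ] ℝ) {k : ℕ} (α : Fin k → ℝ) (v : Fin k → D) (x : P) :
    B x (∑ i, α i • v i) = ∑ i, α i * B x (v i) := by
  simp [map_sum, map_smul]

/-- Two finite linear combinations. -/
theorem dt_bilin_sum_sum {D P : Type*} [AddCommGroup D] [Module ℝ D] [AddCommGroup P] [Module ℝ P]
    (B : D →ₗ[ℝ] P →ₗ[ℝ] ℝ) {k : ℕ} (α γ : Fin k → ℝ) (v : Fin k → D) (u : Fin k → P) :
    B (∑ i, α i • v i) (∑ j, γ j • u j) = ∑ i, ∑ j, α i * γ j * B (v i) (u j) := by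
  rw [dt_bilin_sum_smul_left]
  refine Finset.sum_congr rfl fun i _ ↦ ?_
  rw [dt_bilin_sum_smul_right, Finset.mul_sum]
  exact Finset.sum_congr rfl fun j _ ↦ by ring

/-- **Deflated Temple–Kato (Lehmann–Maehly) bound, two-space decomposition form.**  `D` (form domain) maps
linearly into `D'` (an ambient space carrying the positive semidefinite symmetric pairing `ip`) by `ι`; `E` is a
symmetric bilinear form on `D`; trial vectors `v_i ∈ D`, residual representers `r_i ∈ D'` with
`E(v_i, h) = ip(r_i, ι h)` for `h ⊥ v`; complement bound `β ip(ιh, ιh) ≤ E(h, h)` for `h ⊥ v`; `λ < β` and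
`(β − λ)(A − λG) − R ⪰ 0`.  Then `λ ip(ιg, ιg) ≤ E(g, g)` for every `g = Σ α_i v_i + h`, `h ⊥ v`.
(The one-space case `D' = D`, `ι = id` is `Literature.Analysis.OperatorTheory.deflatedFormBound_of_decomp`; same
three-line proof.) [cite: WeinsteinStenger1972, Ch. 5 §9 eq. (2) (k = 1: Temple's formula)] -/
theorem dt_deflatedFormBound₂ {D D' : Type*} [AddCommGroup D] [Module ℝ D] [AddCommGroup D'] [Module ℝ D']
    (ι : D →ₗ[ℝ] D') (ip : D' →ₗ[ℝ] D' →ₗ[ℝ] ℝ) (E : D →ₗ[ℝ] D →ₗ[ℝ] ℝ)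
    (hip_symm : ∀ x y, ip x y = ip y x) (hip_nonneg : ∀ x, 0 ≤ ip x x) (hE_symm : ∀ x y, E x y = E y x)
    {k : ℕ} (v : Fin k → D) (r : Fin k → D') {β lam : ℝ} (hlam : lam < β)
    (hrepr : ∀ i h, (∀ j, ip (ι (v j)) (ι h) = 0) → E (v i) h = ip (r i) (ι h))
    (hbeta : ∀ h, (∀ j, ip (ι (v j)) (ι h) = 0) → β * ip (ι h) (ι h) ≤ E h h)
    (hPSD : ∀ α : Fin k → ℝ,
      0 ≤ ∑ i, ∑ j, α i * α j *
        ((β - lam) * (E (v i) (v j) - lam * ip (ι (v i)) (ι (v j))) - ip (r i) (r j)))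
    {g h : D} {α : Fin k → ℝ} (hg : g = (∑ i, α i • v i) + h) (horth : ∀ j, ip (ι (v j)) (ι h) = 0) :
    lam * ip (ι g) (ι g) ≤ E g g := by
  -- adapted from Literature/Analysis/OperatorTheory/DeflatedFormBound.lean (deflatedFormBound_of_decomp)
  set w : D := ∑ i, α i • v i with hw
  set x : D' := ∑ i, α i • r i with hx
  have hιw : ι w = ∑ i, α i • ι (v i) := by rw [hw, map_sum]; simp [map_smul]
  have hEwh : E w h = ip x (ι h) := by
    rw [hw, hx, dt_bilin_sum_smul_left, dt_bilin_sum_smul_left]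
    exact Finset.sum_congr rfl fun i _ ↦ by rw [hrepr i h horth]
  have hipwh : ip (ι w) (ι h) = 0 := by
    rw [hιw, dt_bilin_sum_smul_left]
    exact Finset.sum_eq_zero fun i _ ↦ by rw [horth i, mul_zero]
  have hEgg : E g g = E w w + 2 * ip x (ι h) + E h h := by
    rw [hg]
    simp only [map_add, LinearMap.add_apply]
    rw [hE_symm h w, hEwh]
    ring
  have hipgg : ip (ι g) (ι g) = ip (ι w) (ι w) + ip (ι h) (ι h) := by
    rw [hg]
    simp only [map_add, LinearMap.add_apply]
    rw [hip_symm (ι h) (ι w), hipwh]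
    ring
  have hEww : E w w = ∑ i, ∑ j, α i * α j * E (v i) (v j) := by rw [hw, dt_bilin_sum_sum]
  have hipww : ip (ι w) (ι w) = ∑ i, ∑ j, α i * α j * ip (ι (v i)) (ι (v j)) := by
    rw [hιw, dt_bilin_sum_sum]
  have hipxx : ip x x = ∑ i, ∑ j, α i * α j * ip (r i) (r j) := by rw [hx, dt_bilin_sum_sum]
  have hP : 0 ≤ (β - lam) * (E w w - lam * ip (ι w) (ι w)) - ip x x := by
    have e : ∑ i, ∑ j, α i * α j *
        ((β - lam) * (E (v i) (v j) - lam * ip (ι (v i)) (ι (v j))) - ip (r i) (r j)) =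
        (β - lam) * (∑ i, ∑ j, α i * α j * E (v i) (v j)) -
          (β - lam) * lam * (∑ i, ∑ j, α i * α j * ip (ι (v i)) (ι (v j))) -
            ∑ i, ∑ j, α i * α j * ip (r i) (r j) := by
      simp only [Finset.mul_sum]
      rw [← Finset.sum_sub_distrib, ← Finset.sum_sub_distrib]
      refine Finset.sum_congr rfl fun i _ ↦ ?_
      rw [← Finset.sum_sub_distrib, ← Finset.sum_sub_distrib]
      exact Finset.sum_congr rfl fun j _ ↦ by ring
    have h0 := hPSD α
    rw [e] at h0
    rw [hEww, hipww, hipxx]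
    linarith
  have hsq : 0 ≤ ip x x + 2 * (β - lam) * ip x (ι h) + (β - lam) ^ 2 * ip (ι h) (ι h) := by
    have e2 : ip x x + 2 * (β - lam) * ip x (ι h) + (β - lam) ^ 2 * ip (ι h) (ι h) =
        ip (x + (β - lam) • ι h) (x + (β - lam) • ι h) := by
      simp only [map_add, map_smul, LinearMap.add_apply, LinearMap.smul_apply, smul_eq_mul]
      rw [hip_symm (ι h) x]
      ring
    rw [e2]
    exact hip_nonneg _
  have hβ := hbeta h horth
  have hβl : 0 < β - lam := sub_pos.2 hlam
  have hS : 0 ≤ E w w - lam * ip (ι w) (ι w) + 2 * ip x (ι h) + (β - lam) * ip (ι h) (ι h) := by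
    by_contra hneg
    push Not at hneg
    have h1 := mul_neg_of_pos_of_neg hβl hneg
    nlinarith [hP, hsq, h1]
  rw [hEgg, hipgg]
  nlinarith [hS, hβ, hip_nonneg (ι h)]

/-! ## The orthogonal decomposition against real trial vectors -/

/-- Almost-everywhere value of a finite linear combination of `L²(ℝ; ℝ)` elements. -/
theorem dt_Lp_coeFn_sum {k : ℕ} (V : Fin k → Lp ℝ 2 (volume : Measure ℝ)) (α : Fin k → ℝ) :
    ∀ s : Finset (Fin k), ((∑ i ∈ s, α i • V i : Lp ℝ 2 (volume : Measure ℝ)) : ℝ → ℝ) =ᵐ[volume]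
      fun x ↦ ∑ i ∈ s, α i * V i x := by
  classical
  intro s
  induction s using Finset.induction_on with
  | empty =>
    simp only [Finset.sum_empty]
    filter_upwards [Lp.coeFn_zero ℝ 2 (volume : Measure ℝ)] with x hx
    exact hx
  | insert a s ha ih =>
    simp only [Finset.sum_insert ha]
    filter_upwards [Lp.coeFn_add (α a • V a) (∑ i ∈ s, α i • V i), Lp.coeFn_smul (α a) (V a), ih]
      with x h1 h2 h3
    rw [h1, Pi.add_apply, h2, Pi.smul_apply, h3, smul_eq_mul]

/-- **Decomposition against finitely many real `L²` vectors**: for real-valued `g, v₁, …, v_k ∈ L²` there are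
real coefficients `α` with `g − Σ α_i v_i ⊥ v_j` for every `j` (real pairing `∫ Re(v_j · conj ·)`); the `α`
are read off the orthogonal projection of `Re g` onto `span(Re v_i)` in the Hilbert space `L²(ℝ; ℝ)`. -/
theorem dt_exists_orthogonal_decomp {k : ℕ} (v : Fin k → ℝ → ℂ) (hv : ∀ i, MemLp (v i) 2)
    (hvr : ∀ i x, (v i x).im = 0) {g : ℝ → ℂ} (hg : MemLp g 2) (hgr : ∀ x, (g x).im = 0) :
    ∃ α : Fin k → ℝ, ∀ j, ∫ x, (v j x * conj ((g - ∑ i, α i • v i) x)).re = 0 := by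
  classical
  have hgre : MemLp (fun x ↦ (g x).re) 2 volume := by
    simpa only [RCLike.re_to_complex] using hg.re
  have hvre : ∀ i, MemLp (fun x ↦ (v i x).re) 2 volume := fun i ↦ by
    simpa only [RCLike.re_to_complex] using (hv i).re
  set G : Lp ℝ 2 (volume : Measure ℝ) := hgre.toLp _ with hG
  set V : Fin k → Lp ℝ 2 (volume : Measure ℝ) := fun i ↦ (hvre i).toLp _ with hV
  set K : Submodule ℝ (Lp ℝ 2 (volume : Measure ℝ)) := Submodule.span ℝ (Set.range V) with hK
  haveI : FiniteDimensional ℝ K := FiniteDimensional.span_of_finite ℝ (Set.finite_range V)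
  haveI : CompleteSpace K := FiniteDimensional.complete ℝ K
  have hp : K.starProjection G ∈ K := Submodule.starProjection_apply_mem K G
  obtain ⟨α, hα⟩ := (Submodule.mem_span_range_iff_exists_fun ℝ).1 hp
  have hq : G - K.starProjection G ∈ Kᗮ := Submodule.sub_starProjection_mem_orthogonal G
  refine ⟨α, fun j ↦ ?_⟩
  have hVj : V j ∈ K := Submodule.subset_span ⟨j, rfl⟩
  have horth : ⟪V j, G - K.starProjection G⟫_ℝ = 0 := Submodule.inner_right_of_mem_orthogonal hVj hq
  rw [← hα, MeasureTheory.L2.inner_def] at horth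
  have h1 : (V j : ℝ → ℝ) =ᵐ[volume] fun x ↦ (v j x).re := MemLp.coeFn_toLp _
  have hGc : (G : ℝ → ℝ) =ᵐ[volume] fun x ↦ (g x).re := MemLp.coeFn_toLp _
  have hVc : ∀ i, (V i : ℝ → ℝ) =ᵐ[volume] fun x ↦ (v i x).re := fun i ↦ MemLp.coeFn_toLp _
  have hS := dt_Lp_coeFn_sum V α Finset.univ
  have h2 : ((G - ∑ i, α i • V i : Lp ℝ 2 (volume : Measure ℝ)) : ℝ → ℝ) =ᵐ[volume]
      fun x ↦ (g x).re - ∑ i, α i * (v i x).re := by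
    have hall : ∀ᵐ x ∂(volume : Measure ℝ), ∀ i, (V i : ℝ → ℝ) x = (v i x).re :=
      ae_all_iff.2 hVc
    filter_upwards [Lp.coeFn_sub G (∑ i, α i • V i), hGc, hS, hall] with x hx hGx hSx hallx
    rw [hx, Pi.sub_apply, hGx, hSx]
    congr 1
    exact Finset.sum_congr rfl fun i _ ↦ by rw [hallx i]
  rw [← horth]
  refine integral_congr_ae ?_
  filter_upwards [h1, h2] with x hx1 hx2
  rw [hx2]
  simp only [RCLike.inner_apply, conj_trivial, hx1]
  have hsub : (g - ∑ i, α i • v i) x = g x - ∑ i, (α i : ℂ) * v i x := by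
    simp only [Pi.sub_apply, Finset.sum_apply, Pi.smul_apply, Complex.real_smul]
  rw [hsub]
  have him : (g x - ∑ i, (α i : ℂ) * v i x).im = 0 := by
    simp [Complex.sub_im, Complex.im_sum, hgr x, hvr]
  have hre : (g x - ∑ i, (α i : ℂ) * v i x).re = (g x).re - ∑ i, α i * (v i x).re := by
    simp [Complex.sub_re, Complex.re_sum, hvr]
  simp only [Complex.mul_re, Complex.conj_re, Complex.conj_im, hvr j x, him, hre]
  ring

/-! ## The deflated Temple inclusion on the sector form domain -/

/-- **Deflated Temple (Lehmann–Maehly) inclusion on the sector form domain of the window.**  Let `c > 0`,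
`σ ∈ ℂ` (parity sign), trial vectors `v_i ∈ D_c^σ` (`L²`, zero off `[-c, c]`, real-valued, `v_i(-x) = σ v_i(x)`,
finite archimedean energy), window images `F_i ∈ L²` representing `E_c(v_i, ·)` on `D_c^σ`, a coefficient matrix
`W` (residuals `r_i = F_i − Σ_l W_il v_l`), a complement bound `β ∫|h|² ≤ P(h) + 𝓔_c(h) − M_c∫|h|²` for
`h ∈ D_c^σ` with `∫ Re(v_j h̄) = 0` for all `j`, and `λ < β` with `(β − λ)(A − λG) − R ⪰ 0` as a quadratic-form
inequality in the coefficients.  Then `λ ∫|g|² ≤ P(g) + 𝓔_c(g) − M_c ∫|g|²` for every `g ∈ D_c^σ`.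
[cite: WeinsteinStenger1972, Ch. 5 §9 eq. (2) (k = 1: Temple's formula)] -/
theorem dt_deflation_core {c : ℝ} (σ : ℂ) {k : ℕ} (v F : Fin k → ℝ → ℂ) (W : Fin k → Fin k → ℝ)
    {β lam : ℝ} (hlam : lam < β)
    (hv : ∀ i, MemLp (v i) 2 ∧ (∀ x, x ∉ Icc (-c) c → v i x = 0) ∧ (∀ x, (v i x).im = 0) ∧
      (∀ x, v i (-x) = σ * v i x) ∧ IntegrableOn (fun t ↦ weilArchDensity t * weilIncrement (v i) t) (Ioi 0))
    (hF : ∀ i, MemLp (F i) 2)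
    (hrepr : ∀ i (f : ℝ → ℂ), MemLp f 2 → (∀ x, x ∉ Icc (-c) c → f x = 0) → (∀ x, (f x).im = 0) →
      (∀ x, f (-x) = σ * f x) → IntegrableOn (fun t ↦ weilArchDensity t * weilIncrement f t) (Ioi 0) →
      weilPoleForm₂ (v i) f + weilDirichletEnergy₂ c (v i) f -
          weilMarkovConstant c * ∫ x, (v i x * conj (f x)).re = ∫ x, (F i x * conj (f x)).re)
    (hbeta : ∀ h : ℝ → ℂ, MemLp h 2 → (∀ x, x ∉ Icc (-c) c → h x = 0) → (∀ x, (h x).im = 0) →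
      (∀ x, h (-x) = σ * h x) → IntegrableOn (fun t ↦ weilArchDensity t * weilIncrement h t) (Ioi 0) →
      (∀ j, ∫ x, (v j x * conj (h x)).re = 0) →
      β * ∫ x, ‖h x‖ ^ 2 ≤ weilPoleForm h + weilDirichletEnergy c h - weilMarkovConstant c * ∫ x, ‖h x‖ ^ 2)
    (hPSD : ∀ α : Fin k → ℝ, 0 ≤ ∑ i, ∑ j, α i * α j *
      ((β - lam) * ((weilPoleForm₂ (v i) (v j) + weilDirichletEnergy₂ c (v i) (v j) -
          weilMarkovConstant c * ∫ x, (v i x * conj (v j x)).re) - lam * ∫ x, (v i x * conj (v j x)).re) -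
        ∫ x, ((F i - ∑ l, W i l • v l) x * conj ((F j - ∑ l, W j l • v l) x)).re))
    {g : ℝ → ℂ} (hg : MemLp g 2) (hgs : ∀ x, x ∉ Icc (-c) c → g x = 0) (hgr : ∀ x, (g x).im = 0)
    (hgp : ∀ x, g (-x) = σ * g x)
    (hgE : IntegrableOn (fun t ↦ weilArchDensity t * weilIncrement g t) (Ioi 0)) :
    lam * ∫ x, ‖g x‖ ^ 2 ≤
      weilPoleForm g + weilDirichletEnergy c g - weilMarkovConstant c * ∫ x, ‖g x‖ ^ 2 := by
  classical
  -- the ambient space `D' = L²` (as functions) and the sector form domain `D ⊆ D'`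
  let D' : Submodule ℝ (ℝ → ℂ) :=
    { carrier := {f | MemLp f 2 volume}
      add_mem' := fun {f₁ f₂} h₁ h₂ ↦ MemLp.add h₁ h₂
      zero_mem' := MemLp.zero
      smul_mem' := fun a f hf ↦ by
        have e : a • f = fun x ↦ (a : ℂ) * f x := funext fun x ↦ dt_smul_apply a f x
        rw [e]
        exact hf.const_mul _ }
  let D : Submodule ℝ (ℝ → ℂ) :=
    { carrier := {f | MemLp f 2 volume ∧ (∀ x, x ∉ Icc (-c) c → f x = 0) ∧ (∀ x, (f x).im = 0) ∧
        (∀ x, f (-x) = σ * f x) ∧ IntegrableOn (fun t ↦ weilArchDensity t * weilIncrement f t) (Ioi 0)}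
      add_mem' := fun {f₁ f₂} h₁ h₂ ↦ ⟨h₁.1.add h₂.1, fun x hx ↦ by simp [h₁.2.1 x hx, h₂.2.1 x hx],
        fun x ↦ by simp [h₁.2.2.1 x, h₂.2.2.1 x], fun x ↦ by
          simp only [Pi.add_apply, h₁.2.2.2.1 x, h₂.2.2.2.1 x]; ring,
        dt_finiteEnergy_add h₁.1 h₂.1 h₁.2.2.2.2 h₂.2.2.2.2⟩
      zero_mem' := ⟨MemLp.zero, fun _ _ ↦ rfl, fun _ ↦ rfl, fun _ ↦ by simp, dt_finiteEnergy_zero⟩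
      smul_mem' := fun a f hf ↦ ⟨by
          have e : a • f = fun x ↦ (a : ℂ) * f x := funext fun x ↦ dt_smul_apply a f x
          rw [e]; exact hf.1.const_mul _,
        fun x hx ↦ by simp [hf.2.1 x hx], fun x ↦ by simp [hf.2.2.1 x],
        fun x ↦ by rw [dt_smul_apply, dt_smul_apply, hf.2.2.2.1 x]; ring,
        dt_finiteEnergy_smul a f hf.2.2.2.2⟩ }
  have hDD' : D ≤ D' := fun f hf ↦ hf.1
  let ι : D →ₗ[ℝ] D' := Submodule.inclusion hDD'
  -- the pairing on `D'`
  let ip : D' →ₗ[ℝ] D' →ₗ[ℝ] ℝ := LinearMap.mk₂ ℝ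
    (fun f h ↦ ∫ x, ((f : ℝ → ℂ) x * conj ((h : ℝ → ℂ) x)).re)
    (fun f₁ f₂ h ↦ by
      simp only [Submodule.coe_add]
      exact dt_pairing_add_left f₁.2 f₂.2 h.2)
    (fun a f h ↦ by
      simp only [Submodule.coe_smul, smul_eq_mul]
      exact dt_pairing_smul_left a _ _)
    (fun f h₁ h₂ ↦ by
      simp only [Submodule.coe_add]
      rw [dt_pairing_comm, dt_pairing_add_left h₁.2 h₂.2 f.2, dt_pairing_comm (h₁ : ℝ → ℂ),
        dt_pairing_comm (h₂ : ℝ → ℂ)])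
    (fun a f h ↦ by
      simp only [Submodule.coe_smul, smul_eq_mul]
      rw [dt_pairing_comm, dt_pairing_smul_left, dt_pairing_comm])
  have hip : ∀ f h : D', ip f h = ∫ x, ((f : ℝ → ℂ) x * conj ((h : ℝ → ℂ) x)).re := fun f h ↦ rfl
  -- the closed form on `D`
  let E : D →ₗ[ℝ] D →ₗ[ℝ] ℝ := LinearMap.mk₂ ℝ
    (fun f h ↦ weilPoleForm₂ (f : ℝ → ℂ) h + weilDirichletEnergy₂ c (f : ℝ → ℂ) h -
      weilMarkovConstant c * ∫ x, ((f : ℝ → ℂ) x * conj ((h : ℝ → ℂ) x)).re)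
    (fun f₁ f₂ h ↦ by
      simp only [Submodule.coe_add]
      exact dt_closedForm_add_left c f₁.2.1 f₂.2.1 h.2.1 f₁.2.2.1 f₂.2.2.1 f₁.2.2.2.2.2 f₂.2.2.2.2.2
        h.2.2.2.2.2)
    (fun a f h ↦ by
      simp only [Submodule.coe_smul, smul_eq_mul]
      exact dt_closedForm_smul_left c a _ _)
    (fun f h₁ h₂ ↦ by
      simp only [Submodule.coe_add]
      rw [dt_closedForm_comm, dt_closedForm_add_left c h₁.2.1 h₂.2.1 f.2.1 h₁.2.2.1 h₂.2.2.1 h₁.2.2.2.2.2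
        h₂.2.2.2.2.2 f.2.2.2.2.2, dt_closedForm_comm c (h₁ : ℝ → ℂ), dt_closedForm_comm c (h₂ : ℝ → ℂ)])
    (fun a f h ↦ by
      simp only [Submodule.coe_smul, smul_eq_mul]
      rw [dt_closedForm_comm, dt_closedForm_smul_left, dt_closedForm_comm])
  have hE : ∀ f h : D, E f h = weilPoleForm₂ (f : ℝ → ℂ) h + weilDirichletEnergy₂ c (f : ℝ → ℂ) h -
      weilMarkovConstant c * ∫ x, ((f : ℝ → ℂ) x * conj ((h : ℝ → ℂ) x)).re := fun f h ↦ rfl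
  -- the vectors
  let vD : Fin k → D := fun i ↦ ⟨v i, hv i⟩
  let FD : Fin k → D' := fun i ↦ ⟨F i, hF i⟩
  let rD : Fin k → D' := fun i ↦ FD i - ∑ l, W i l • ι (vD l)
  have hgD : g ∈ D := ⟨hg, hgs, hgr, hgp, hgE⟩
  -- the decomposition
  obtain ⟨α, hα⟩ := dt_exists_orthogonal_decomp v (fun i ↦ (hv i).1) (fun i ↦ (hv i).2.2.1) hg hgr
  have hhD : g - ∑ i, α i • v i ∈ D :=
    D.sub_mem hgD (D.sum_mem fun i _ ↦ D.smul_mem (α i) (hv i))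
  let gD : D := ⟨g, hgD⟩
  let hD : D := ⟨g - ∑ i, α i • v i, hhD⟩
  have hdecomp : gD = (∑ i, α i • vD i) + hD := by
    apply Subtype.ext
    simp only [Submodule.coe_add, Submodule.coe_sum, Submodule.coe_smul, gD, hD, vD]
    abel
  have hcoeι : ∀ f : D, ((ι f : D') : ℝ → ℂ) = (f : ℝ → ℂ) := fun f ↦ rfl
  have horth : ∀ j, ip (ι (vD j)) (ι hD) = 0 := fun j ↦ by
    rw [hip, hcoeι, hcoeι]; exact hα j
  -- apply the abstract lemma
  have key := dt_deflatedFormBound₂ ι ip E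
    (fun x y ↦ by rw [hip, hip, dt_pairing_comm])
    (fun x ↦ by rw [hip]; exact dt_pairing_self_nonneg _)
    (fun x y ↦ by rw [hE, hE, dt_closedForm_comm])
    vD rD hlam ?_ ?_ ?_ hdecomp horth
  · -- conclusion
    rw [hip, hE, hcoeι] at key
    simpa only [gD, weilPoleForm₂_self, weilDirichletEnergy₂_self, dt_pairing_self] using key
  · -- (repr)
    intro i h hh
    have hcoer : ((rD i : D') : ℝ → ℂ) = F i - ∑ l, W i l • v l := by
      simp only [rD, FD, Submodule.coe_sub, Submodule.coe_sum, Submodule.coe_smul, hcoeι, vD]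
    have h0 : ∀ l, ∫ x, (v l x * conj ((h : ℝ → ℂ) x)).re = 0 := fun l ↦ by
      have := hh l; rwa [hip, hcoeι, hcoeι] at this
    rw [hE, hrepr i h h.2.1 h.2.2.1 h.2.2.2.1 h.2.2.2.2.1 h.2.2.2.2.2]
    rw [show ip (rD i) (ι h) = ip (FD i) (ι h) - ∑ l, W i l * ip (ι (vD l)) (ι h) by
      simp only [rD, map_sub, LinearMap.sub_apply, dt_bilin_sum_smul_left]]
    have hF0 : ip (FD i) (ι h) = ∫ x, (F i x * conj ((h : ℝ → ℂ) x)).re := rfl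
    have hv0 : ∀ l, ip (ι (vD l)) (ι h) = 0 := fun l ↦ by rw [hip, hcoeι, hcoeι]; exact h0 l
    simp only [hF0, hv0, mul_zero, Finset.sum_const_zero, sub_zero]
  · -- (β)
    intro h hh
    have h0 : ∀ l, ∫ x, (v l x * conj ((h : ℝ → ℂ) x)).re = 0 := fun l ↦ by
      have := hh l; rwa [hip, hcoeι, hcoeι] at this
    rw [hip, hE, hcoeι, dt_closedForm_self, dt_pairing_self]
    exact hbeta h h.2.1 h.2.2.1 h.2.2.2.1 h.2.2.2.2.1 h.2.2.2.2.2 h0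
  · -- (PSD)
    intro α'
    have hcoer : ∀ i, ((rD i : D') : ℝ → ℂ) = F i - ∑ l, W i l • v l := fun i ↦ by
      simp only [rD, FD, Submodule.coe_sub, Submodule.coe_sum, Submodule.coe_smul, hcoeι, vD]
    have e : ∀ i j, (β - lam) * (E (vD i) (vD j) - lam * ip (ι (vD i)) (ι (vD j))) - ip (rD i) (rD j) =
        (β - lam) * ((weilPoleForm₂ (v i) (v j) + weilDirichletEnergy₂ c (v i) (v j) -
          weilMarkovConstant c * ∫ x, (v i x * conj (v j x)).re) - lam * ∫ x, (v i x * conj (v j x)).re) -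
        ∫ x, ((F i - ∑ l, W i l • v l) x * conj ((F j - ∑ l, W j l • v l) x)).re := by
      intro i j
      rw [hE, hip, hip, hcoeι, hcoeι, hcoer, hcoer]
    simp only [e]
    exact hPSD α'

end Summit.RiemannHypothesis.RiemannHypothesis.Theorems.EvenWinsBeyondArch

end
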